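import Summits.QuantumFields.YangMills.Theorems.MirrorModularBoostsSoftKernelBoostCovarianceTameSector
import Summits.QuantumFields.YangMills.Theses.CertificationLength

/-!
# Sketch — crux-ideate stmt-QuantumFields-15892 (`CertificationLength.NPointIsotropyBelowThreshold`), ideator 1, round 1

First lemmas of the two idea cards (statements elaborate; proofs are `sorry` except the two cheap ones):

* card `graded-sandwich-tower` (§A): the sieve consumes the heat-sandwich bound DEGREE BY DEGREE, so the
  Yang–Mills input may be graded by the degree of the spectator state, with degree-dependent constants;
  degree 0 is the soft kernel (vacuum row), degree 1 is a 4-point statement (one-particle Schur bound) and gives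
  planar isotropy of `𝔖₃, 𝔖₄`.
* card `subcritical-schemes-are-tame` (§B): per-lattice-step spectral contraction of the scheme's own doubled
  truncated curvature correlations (lattice-unit gap, frequently in `k`) + the tie ⇒ every truncated function of
  the limit vanishes on `⁰𝒮` ⇒ `PlanarInvariant`; the crux is equivalent to its restriction to LATTICE-CRITICAL
  wild schemes.
-/

noncomputable section

attribute [-instance] SimplexCategory.instFintypeToTypeOrderHomFinHAddNatLenOfNat

open scoped BigOperators SchwartzMap InnerProductSpace
open MeasureTheory Filter Topology
open Literature.MathematicalPhysics.QuantumLattice Literature.MathematicalPhysics.AQFT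
  Literature.MathematicalPhysics.QuantumFieldTheory
open Summit.QuantumFields.YangMills.Theorems.NPointIsotropy.Negative (E4 NPointRegular)
open Summit.QuantumFields.YangMills.Theorems.CurvatureBoostCovariance.Negative
  (OSPackage Translations Hypercubic EightFrameRP PlanarCone PlanarInvariant Tie Gaps W1)
open Summit.QuantumFields.YangMills.Theorems.SoftKernelBoostCovariance.Negative (SoftKernel)

namespace Summit.QuantumFields.YangMills.Cruxes.NPointIsotropyBelowThreshold.Ideator1

/-! ## §A  `graded-sandwich-tower` -/

/-- The `e₀`-frame heat-sandwich row of Σ (transversely filtered insertion `f₁ = g ⊗ hh` at scale `(u,v)`)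
restricted to SPECTATOR STATES OF ONE FIXED DEGREE `n`, with constants `(μ, C)` (verbatim the quantified body
of the landed `stub_planarInvariantOfInputsWeak`, with the degree `n` moved OUT of the bound). -/
def SandwichRowAtDegree (S₁ : SchwingerFamily E4) (h : OSReconstructionNoE1 S₁.toLabelled) (n : ℕ)
    (μ C : ℝ) : Prop :=
  ∀ (u v : ℝ), 0 < u → 0 < v → u ≤ 1 → v ≤ 1 →
    ∀ (f₁ : SchwartzMap (Fin 1 → E4) ℂ) (g hh : ℝ × ℝ → ℂ) (Mg Mh Mh' : ℝ),
      (∀ x : Fin 1 → E4, f₁ x = g (x 0 0, x 0 1) * hh (x 0 2, x 0 3)) →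
      (∀ p : ℝ × ℝ, g p ≠ 0 → u ≤ p.1 ∧ p.1 ≤ 2 * u) →
      MeasureTheory.Integrable g → (∫ p, ‖g p‖) ≤ Mg →
      MeasureTheory.Integrable hh → (∫ p, ‖hh p‖) ≤ Mh → (∀ p, ‖hh p‖ ≤ Mh') →
    ∀ (W : SchwartzMap (Fin n → E4) ℂ) (hW : IsTimeOrdered W)
      (hFW : IsTimeOrdered
        (SchwartzMap.appendTensor f₁ (translateMulti ((2 * u + v) • EuclideanSpace.single 0 1) W))),
      ‖h.fieldVec (1 + n) (fun _ => ())
          (SchwartzMap.appendTensor f₁ (translateMulti ((2 * u + v) • EuclideanSpace.single 0 1) W)) hFW‖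
        ≤ C * Mg * (Mh + Mh') * (u ^ (-μ) + v ^ (-μ)) * ‖h.fieldVec n (fun _ => ()) W hW‖

/-- **Graded Σ (the `e₀` frame):** for every degree `n` SOME sub-threshold exponent `μₙ < 4` and constant `Cₙ`
(both may depend on `n`). -/
def GradedSandwichLt4 (S₁ : SchwingerFamily E4) : Prop :=
  ∀ (h : OSReconstructionNoE1 S₁.toLabelled) (n : ℕ), ∃ μ C : ℝ, μ < 4 ∧ SandwichRowAtDegree S₁ h n μ C

/-- **Graded Σ, any exponent** (what the `45°` pull-back family has to supply). -/
def GradedSandwichAny (S₁ : SchwingerFamily E4) : Prop :=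
  ∀ (h : OSReconstructionNoE1 S₁.toLabelled) (n : ℕ), ∃ μ C : ℝ, SandwichRowAtDegree S₁ h n μ C

/-- The uniform row (Σ as typed, `e₀` frame) trivially implies the graded one. -/
theorem gradedSandwichLt4_of_uniform (S₁ : SchwingerFamily E4)
    (hS : ∀ (h : OSReconstructionNoE1 S₁.toLabelled), ∃ μ C : ℝ, μ < 4 ∧ ∀ n, SandwichRowAtDegree S₁ h n μ C) :
    GradedSandwichLt4 S₁ := fun h n => by
  obtain ⟨μ, C, hμ, hrow⟩ := hS h
  exact ⟨μ, C, hμ, hrow n⟩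

/-- **FIRST LEMMA of card `graded-sandwich-tower`** (the re-plumbed pointwise composition): the landed level
induction pays ONE insertion per level and applies the sandwich only to spectator states of LOWER degree
(`stub_insertionOps` at degree `n − 1 − j` inside `stub_asmBumpChainOps` / `stub_asmTermChainFree`), so the
graded rows suffice: OS package + translations + proper hypercubic + eight frames + cone + soft kernel + Step 0
+ graded Σ (`e₀`: `μₙ < 4`; `45°` pull-back: any `μₙ`) ⇒ planar invariance on `⁰𝒮`. -/
theorem planarInvariant_of_gradedSandwich (S₁ : SchwingerFamily E4) (hOS : OSPackage S₁)
    (htr : Translations S₁) (hhyp : Hypercubic S₁) (h8 : EightFrameRP S₁) (hC : PlanarCone S₁)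
    (hK : SoftKernel S₁) (hreg : NPointRegular S₁) (hSig : GradedSandwichLt4 S₁)
    (hSig' : GradedSandwichAny (fun n => (S₁ n).comp (linActMulti (planeRot (0 : Fin 3) (Real.pi / 4))))) :
    PlanarInvariant S₁ := by
  sorry

/-- **Σ₁ — the degree-one row** (spectators `Ψ(w)`, `w` ONE field): a bound on 4-point over 2-point doubled
Schwinger functions, uniform over one-field time-ordered `w`; with the radial soft kernel the one-field sector is
the explicit Källén–Lehmann `L²`-model, so Σ₁ is a Schur-test inequality on the mixed 4-point kernel. -/
def SigmaOne (S₁ : SchwingerFamily E4) : Prop :=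
  ∀ (h : OSReconstructionNoE1 S₁.toLabelled), ∃ μ C : ℝ, μ < 4 ∧ SandwichRowAtDegree S₁ h 1 μ C

/-- **Milestone of the graded tower: isotropy through degree four from 4-point data.**  Degree 0 of the graded
row is the vacuum row of the soft kernel (landed calibration `μ₀ = 4 − η/2`), degree 1 is `SigmaOne`; two levels
of the sieve give invariance of `𝔖ₙ|⁰𝒮` for `n ≤ 4` (the first non-Gaussian degrees, `κ₃, κ₄`). -/
theorem planarInvariant_le_four_of_sigmaOne (S₁ : SchwingerFamily E4) (hOS : OSPackage S₁)
    (htr : Translations S₁) (hhyp : Hypercubic S₁) (h8 : EightFrameRP S₁) (hC : PlanarCone S₁)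
    (hK : SoftKernel S₁) (hreg : NPointRegular S₁) (hS1 : SigmaOne S₁)
    (hS1' : ∀ (h : OSReconstructionNoE1
        (SchwingerFamily.toLabelled (fun n => (S₁ n).comp (linActMulti (planeRot (0 : Fin 3) (Real.pi / 4)))))),
        ∃ μ C : ℝ, SandwichRowAtDegree
          (fun n => (S₁ n).comp (linActMulti (planeRot (0 : Fin 3) (Real.pi / 4)))) h 1 μ C) :
    ∀ (R : E4 ≃ₗᵢ[ℝ] E4), LinearMap.det (R.toLinearEquiv : E4 →ₗ[ℝ] E4) = 1 →
      R (EuclideanSpace.single 2 1) = EuclideanSpace.single 2 1 →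
      R (EuclideanSpace.single 3 1) = EuclideanSpace.single 3 1 →
      ∀ (n : ℕ), n ≤ 4 → ∀ (F : 𝓢((Fin n → E4), ℂ)), IsOffDiagonal F → S₁ n (linActMulti R F) = S₁ n F := by
  sorry

/-! ## §B  `subcritical-schemes-are-tame` -/

section Lattice

variable {G : Type} [Group G] [TopologicalSpace G] [IsTopologicalGroup G] [CompactSpace G]
  [MeasurableSpace G] [BorelSpace G]

/-- The DOUBLED TRUNCATED lattice two-slot correlation of the renormalised curvature field at step `k` on the
scheme's own torus, for two real tests `g₀, g₁` (intended: `g₀ = θg`, `g₁` a time-translate of `g`). -/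
def doubledTruncated (r : LatticeRep G) (sch : SpeciesScheme (YMSpecies G)) (k : ℕ)
    (g₀ g₁ : 𝓢(E4, ℝ)) : ℝ :=
  latticeSchwinger r.ρ sch (fun s => s.F) k 2 (fun _ => r.curvature) ![g₀, g₁] -
    latticeSchwinger r.ρ sch (fun s => s.F) k 1 (fun _ => r.curvature) ![g₀] *
      latticeSchwinger r.ρ sch (fun s => s.F) k 1 (fun _ => r.curvature) ![g₁]

/-- **Frequently subcritical scheme** (lattice-unit gap in the curvature sector of the scheme's OWN tori, in the
spectral/per-step form the transfer matrix gives, wrap-around included): for some `ξ > 0` and infinitely many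
`k`, translating the positive-time member of a reflected pair by `s` further LATTICE steps contracts the doubled
truncated correlation by `e^{-s/ξ}`. -/
def FrequentlySubcritical (r : LatticeRep G) (sch : SpeciesScheme (YMSpecies G)) : Prop :=
  ∃ ξ : ℝ, 0 < ξ ∧ ∃ᶠ k in atTop, ∀ (g : 𝓢(E4, ℝ)) (t s : ℕ) (g₀ gt gts : 𝓢(E4, ℝ)),
    (∀ x : E4, g x ≠ 0 → 0 < x 0) →
    (∀ x : E4, g₀ x = g (timeReflection 4 x)) →
    (∀ x : E4, gt x = g (x - ((t : ℝ) * sch.a k) • EuclideanSpace.single 0 1)) →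
    (∀ x : E4, gts x = g (x - (((t : ℝ) + s) * sch.a k) • EuclideanSpace.single 0 1)) →
      doubledTruncated r sch k g₀ gts ≤ Real.exp (-(s : ℝ) / ξ) * doubledTruncated r sch k g₀ gt

/-- **The two-line core** (pure analysis, proved): if two sequences converge, are frequently related by the
per-step contraction with `s_k = δ/a_k → ∞` steps, and the second is eventually nonnegative, the first limit is `0`. -/
theorem limit_eq_zero_of_contraction {Q₁ Q₂ : ℕ → ℝ} {s : ℕ → ℝ} {ξ L₁ L₂ : ℝ} (hξ : 0 < ξ)
    (hs : Tendsto s atTop atTop) (h₁ : Tendsto Q₁ atTop (𝓝 L₁)) (h₂ : Tendsto Q₂ atTop (𝓝 L₂))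
    (hpos : ∀ᶠ k in atTop, 0 ≤ Q₂ k)
    (hcontr : ∃ᶠ k in atTop, Q₂ k ≤ Real.exp (-(s k) / ξ) * Q₁ k) : L₂ = 0 := by
  have hexp : Tendsto (fun k => Real.exp (-(s k) / ξ) * Q₁ k) atTop (𝓝 0) := by
    have h0 : Tendsto (fun k => Real.exp (-(s k) / ξ)) atTop (𝓝 0) := by
      refine Real.tendsto_exp_atBot.comp ?_
      have h' : Tendsto (fun k => s k / ξ) atTop atTop := hs.atTop_div_const hξ
      have h'' : Tendsto (fun k => -(s k / ξ)) atTop atBot := tendsto_neg_atTop_atBot.comp h'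
      simpa [neg_div] using h''
    simpa using h0.mul h₁
  have hL₂ : 0 ≤ L₂ := ge_of_tendsto h₂ hpos
  by_contra hne
  have hL : 0 < L₂ := lt_of_le_of_ne hL₂ (Ne.symm hne)
  have hev₁ : ∀ᶠ k in atTop, L₂ / 2 < Q₂ k := h₂.eventually (eventually_gt_nhds (by linarith))
  have hev₂ : ∀ᶠ k in atTop, Real.exp (-(s k) / ξ) * Q₁ k < L₂ / 2 :=
    hexp.eventually (eventually_lt_nhds (by linarith))
  obtain ⟨k, hk, hk₁, hk₂⟩ := (hcontr.and_eventually (hev₁.and hev₂)).exists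
  linarith

/-- **FIRST LEMMA of card `subcritical-schemes-are-tame`** (crux vocabulary): a tied curvature package along a
frequently subcritical scheme has all truncated functions vanishing on `⁰𝒮` (c-number family), hence is planar
invariant — no soft kernel, no frames, no sandwich needed.  The crux is thereby equivalent to its restriction to
schemes that are NOT frequently subcritical (lattice-critical along the whole sequence). -/
theorem planarInvariant_of_frequentlySubcritical (r : LatticeRep G) (sch : SpeciesScheme (YMSpecies G))
    (S₁ : SchwingerFamily E4) (hW : W1 r sch S₁) (hsub : FrequentlySubcritical r sch) :
    PlanarInvariant S₁ := by
  sorry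

end Lattice

end Summit.QuantumFields.YangMills.Cruxes.NPointIsotropyBelowThreshold.Ideator1

end
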